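import Summits.Ventures.YMGap.RobustBall.LocalSourceScreeningBall
import HarnessLib

/-!
# Venture YMGap, track ROBUST-BALL (Y2) — the SCREENING CURRENCY `LocalScreeningOnBallZd`: one screening rate and
# one constant for every member of the tier-1 ball, every source and every pair of DLR states

HONEST FRAMING. WHAT THIS IS: a venture file (cell `pub-ymgap`, track Y2 ROBUST-BALL, seat rb-p1): the TYPED CURRENCY
of the screening estimate of `LocalSourceScreening[Metric|Ball].lean`, in the shape of the track's uniform currencies
(`UniformMassGapOnBallZd d N β ε₀ ε₁ R m A`):

  `LocalScreeningOnBallZd d N β ε₀ ε₁ R m A` := for EVERY member `(W, supp) ∈ MemBallZd ε₀ ε₁ R`, EVERY bounded adapted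
  source `V` (locally listed by `suppV`, one-link oscillation witnesses `oscV`, per-link loads `≤ B` and `= 0` off the
  finite link set `S`; ANY strength, ANY range), every DLR state `μ` of the member at 't Hooft coupling `β`, EVERY DLR
  state `ν` of `W + V`, and every Lipschitz cylinder observable `F` (links `Λ`, constant `K_F`):
  `|∫ F dμ − ∫ F dν| ≤ A · min(B, 4) · e^{−m · d(Λ, S)} · #Λ · K_F`.

Nothing is asserted by the definition.  Bridges (theorems): `localScreeningOnBallZd_of_pair` (any one-link
Poincaré/variance pair: `m = κ/max(1,R)`, `A = (√N/2) e^{κ}/(1 − max(ρ,½))`, `κ = −log max(ρ,½)` — the rate of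
`UniformMassGapKR`), `…_of_pair_linear` (`1/2 ≤ ρ < 1`: `m = (1−ρ)/max(1,R)`, `A = √N/(1−ρ)`), `su2_localScreeningOnBallZd[_dim4]`
(`2(d−1)|β_W| e^{ε₀} + e^{ε₀/2} √(2/3) ε₁ ≤ ρ`: `A = √2/(1−ρ)`), the cell `su2_localScreeningOnBallZd_1_8`
(`(β_W; ε₀, ε₁) = (1/8; 1/10, 1/20)`: `m = (1/8)/max(1,R)`, `A = 8√2`), every `N` (`suN_localScreeningOnBallZd_bakryEmery`),
monotonicity `LocalScreeningOnBallZd.mono`, and the GLOBAL reading `LocalScreeningOnBallZd.stateStability` (`d(Λ,S) ≥ 0`: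
the state is Lipschitz across sources, constant `A · min(B,4)`, ds-1's STATE-STABILITY shape).
WHAT THIS IS NOT: `m` is a one-sided Dobrushin-comparison screening rate (a lower bound on the inverse screening
length); lattice strong coupling only, nothing about the continuum limit or a Clay-sense mass gap.
-/

noncomputable section

open MeasureTheory Filter Function ProbabilityTheory Real Topology
open scoped NNReal
open Literature.Probability.LatticeModels
open Literature.Probability.LatticeModels.DobrushinMetric
open Literature.MathematicalPhysics.QuantumLattice
open Literature.MathematicalPhysics.QuantumFieldTheory hiding ZdEdge Site
open Summit.QuantumFields.BalabanUV.InfraRed.StrongCouplingPoincareDoorSUN (OneLinkPoincareSUN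
  oneLinkPoincareSUN_two_sharp oneLinkPoincareSUN_bakryEmery)
open Summit.QuantumFields.BalabanUV.InfraRed.StrongCouplingVarianceDoorSUN (OneLinkVarianceBound
  oneLinkVarianceBound_bakryEmery)

namespace Summit.Ventures.YMGap.RobustBall

variable {d N : ℕ}

variable (d N) in
/-- **THE SCREENING CURRENCY — local sources are screened uniformly on the tier-1 `ℤ^d` ball with rate `m` and
constant `A`**: for every member `(W, supp)` of `MemBallZd ε₀ ε₁ R`, every bounded adapted source `V` listed by `suppV`
with one-link oscillation witnesses `oscV` whose per-link loads are `≤ B` everywhere and `≤ 0` off the finite link set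
`S`, every DLR state `μ` of the member at 't Hooft coupling `β`, every DLR state `ν` of `W + V` (listed by
`supp ∪ suppV`) and every Lipschitz cylinder observable `F` (`Λ`, `K_F`):
`|∫ F dμ − ∫ F dν| ≤ A · min(B,4) · e^{−m d(Λ,S)} · #Λ · K_F`.  Nothing is asserted by the definition. -/
def LocalScreeningOnBallZd (β ε₀ ε₁ R m A : ℝ) : Prop :=
  ∀ (W : Potential (ZdEdge d) (Matrix.specialUnitaryGroup (Fin N) ℂ))
    (supp : Finset (ZdEdge d) → Finset (Finset (ZdEdge d))), MemBallZd ε₀ ε₁ R W supp →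
  ∀ (V : Potential (ZdEdge d) (Matrix.specialUnitaryGroup (Fin N) ℂ)), V.IsAdapted → (∀ X, ∃ C, ∀ U, |V X U| ≤ C) →
  ∀ (suppV : Finset (ZdEdge d) → Finset (Finset (ZdEdge d))), V.IsSupportedBy suppV →
  ∀ (oscV : Finset (ZdEdge d) → ZdEdge d → ℝ), (∀ X, Dobrushin.IsOscBound (V X) (oscV X)) →
  ∀ (B : ℝ) (S : Finset (ZdEdge d)), (∀ e, ∑ X ∈ (suppV {e}).filter (fun X => e ∈ X), oscV X e ≤ B) →
    (∀ e, e ∉ S → ∑ X ∈ (suppV {e}).filter (fun X => e ∈ X), oscV X e ≤ 0) →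
  ∀ μ ∈ perturbedGibbsMeasures (d := d) (fundamentalRep (Fin N)) (N * β) W supp,
  ∀ ν ∈ perturbedGibbsMeasures (d := d) (fundamentalRep (Fin N)) (N * β) (W + V) (fun Λ => supp Λ ∪ suppV Λ),
  ∀ (F : LGConfig d (Matrix.specialUnitaryGroup (Fin N) ℂ) → ℝ) (Λ : Finset (ZdEdge d)) (KF : ℝ≥0),
    IsLipschitzCylinder (fundamentalRep (Fin N)) F Λ KF →
      |(∫ σ, F σ ∂μ) - ∫ σ, F σ ∂ν| ≤ A * min B 4 * exp (-m * setDistEdges Λ S) * (Λ.card * KF)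

/-- **Monotonicity**: a smaller rate and a larger constant are implied. -/
theorem LocalScreeningOnBallZd.mono {β ε₀ ε₁ R m A m' A' : ℝ} (h : LocalScreeningOnBallZd d N β ε₀ ε₁ R m A)
    (hm : m' ≤ m) (hA : A ≤ A') (hA0 : 0 ≤ A) : LocalScreeningOnBallZd d N β ε₀ ε₁ R m' A' := by
  intro W supp hmem V hV hVb suppV hsuppV oscV hoscV B S hB hS μ hμ ν hν F Λ KF hF
  have key := h W supp hmem V hV hVb suppV hsuppV oscV hoscV B S hB hS μ hμ ν hν F Λ KF hF
  rcases Λ.eq_empty_or_nonempty with hΛ | ⟨e, he⟩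
  · subst hΛ
    simpa using key
  refine key.trans ?_
  have hB0 : 0 ≤ min B 4 := le_min ((Finset.sum_nonneg fun X _ => (hoscV X).nonneg e).trans (hB e)) (by norm_num)
  have hexp : exp (-m * setDistEdges Λ S) ≤ exp (-m' * setDistEdges Λ S) :=
    exp_le_exp.2 (by nlinarith [setDistEdges_nonneg Λ S])
  have hΛK : (0 : ℝ) ≤ Λ.card * KF := by positivity
  have hA'B : 0 ≤ A' * min B 4 := mul_nonneg (hA0.trans hA) hB0
  gcongr

/-- **The global reading (STATE-STABILITY shape)**: dropping the distance, the state is Lipschitz across sources —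
`|∫ F dμ − ∫ F dν| ≤ A · min(B,4) · #Λ · K_F` for every member, source and Lipschitz cylinder (`m ≥ 0`). -/
theorem LocalScreeningOnBallZd.stateStability {β ε₀ ε₁ R m A : ℝ} (h : LocalScreeningOnBallZd d N β ε₀ ε₁ R m A)
    (hm : 0 ≤ m) (hA0 : 0 ≤ A)
    {W : Potential (ZdEdge d) (Matrix.specialUnitaryGroup (Fin N) ℂ)}
    {supp : Finset (ZdEdge d) → Finset (Finset (ZdEdge d))} (hmem : MemBallZd ε₀ ε₁ R W supp)
    {V : Potential (ZdEdge d) (Matrix.specialUnitaryGroup (Fin N) ℂ)} (hV : V.IsAdapted)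
    (hVb : ∀ X, ∃ C, ∀ U, |V X U| ≤ C)
    {suppV : Finset (ZdEdge d) → Finset (Finset (ZdEdge d))} (hsuppV : V.IsSupportedBy suppV)
    {oscV : Finset (ZdEdge d) → ZdEdge d → ℝ} (hoscV : ∀ X, Dobrushin.IsOscBound (V X) (oscV X))
    {B : ℝ} (hB : ∀ e, ∑ X ∈ (suppV {e}).filter (fun X => e ∈ X), oscV X e ≤ B) {S : Finset (ZdEdge d)}
    (hS : ∀ e, e ∉ S → ∑ X ∈ (suppV {e}).filter (fun X => e ∈ X), oscV X e ≤ 0)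
    {μ ν : Measure (LGConfig d (Matrix.specialUnitaryGroup (Fin N) ℂ))}
    (hμ : μ ∈ perturbedGibbsMeasures (d := d) (fundamentalRep (Fin N)) (N * β) W supp)
    (hν : ν ∈ perturbedGibbsMeasures (d := d) (fundamentalRep (Fin N)) (N * β) (W + V)
      (fun Λ => supp Λ ∪ suppV Λ))
    {F : LGConfig d (Matrix.specialUnitaryGroup (Fin N) ℂ) → ℝ} {Λ : Finset (ZdEdge d)} {KF : ℝ≥0}
    (hF : IsLipschitzCylinder (fundamentalRep (Fin N)) F Λ KF) :
    |(∫ σ, F σ ∂μ) - ∫ σ, F σ ∂ν| ≤ A * min B 4 * (Λ.card * KF) := by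
  have key := h W supp hmem V hV hVb suppV hsuppV oscV hoscV B S hB hS μ hμ ν hν F Λ KF hF
  rcases Λ.eq_empty_or_nonempty with hΛ | ⟨e, he⟩
  · subst hΛ
    simpa using key
  refine key.trans ?_
  have hB0 : 0 ≤ min B 4 := le_min ((Finset.sum_nonneg fun X _ => (hoscV X).nonneg e).trans (hB e)) (by norm_num)
  have hexp : exp (-m * setDistEdges Λ S) ≤ 1 :=
    exp_le_one_iff.2 (by nlinarith [setDistEdges_nonneg Λ S])
  have hΛK : (0 : ℝ) ≤ Λ.card * KF := by positivity
  calc A * min B 4 * exp (-m * setDistEdges Λ S) * (Λ.card * KF) ≤ A * min B 4 * 1 * (Λ.card * KF) := by gcongr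
    _ = A * min B 4 * (Λ.card * KF) := by ring

/-! ### Bridges: the pair door -/

/-- **The screening currency from a one-link pair**: `6(d−1)|β| e^{ε₀} √(c v) + e^{ε₀/2} √c ε₁ ≤ ρ < 1 ⇒
LocalScreeningOnBallZd d N β ε₀ ε₁ R (κ/max(1,R)) ((√N/2) e^{κ}/(1 − max(ρ,½)))`, `κ = −log max(ρ,½)`. -/
theorem localScreeningOnBallZd_of_pair (hd : 1 ≤ d) (hN : 1 ≤ N) {β b c v ε₀ ε₁ ρ : ℝ} (R : ℝ) (hc : 0 ≤ c)
    (hv : 0 ≤ v) (hb : |β| * (2 * ((d : ℝ) - 1)) ≤ b)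
    (hP : ∀ B : Matrix (Fin N) (Fin N) ℂ, matrixOpNorm B ≤ b →
      ∀ (ψ : Matrix.specialUnitaryGroup (Fin N) ℂ → ℝ) (M : ℝ), 0 ≤ M →
        (∀ x y, |ψ x - ψ y| ≤ M * suFrobDist x y) →
        Var[ψ; (haarProbability (Matrix.specialUnitaryGroup (Fin N) ℂ)).tilted
          fun g => (N : ℝ) * ((g : Matrix (Fin N) (Fin N) ℂ) * B).trace.re] ≤ c * M ^ 2)
    (hVB : ∀ B : Matrix (Fin N) (Fin N) ℂ, matrixOpNorm B ≤ b → ∀ Δ : Matrix (Fin N) (Fin N) ℂ,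
      Var[fun g : Matrix.specialUnitaryGroup (Fin N) ℂ =>
          (N : ℝ) * ((g : Matrix (Fin N) (Fin N) ℂ) * Δ).trace.re;
        (haarProbability (Matrix.specialUnitaryGroup (Fin N) ℂ)).tilted
          fun g => (N : ℝ) * ((g : Matrix (Fin N) (Fin N) ℂ) * B).trace.re] ≤ v * frobNorm Δ ^ 2)
    (hρ : 6 * ((d : ℝ) - 1) * |β| * (exp ε₀ * Real.sqrt (c * v)) + exp (ε₀ / 2) * Real.sqrt c * ε₁ ≤ ρ)
    (hρ1 : ρ < 1) :
    LocalScreeningOnBallZd d N β ε₀ ε₁ R (-Real.log (max ρ (1 / 2)) / max 1 R)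
      (Real.sqrt N / 2 * exp (-Real.log (max ρ (1 / 2))) / (1 - max ρ (1 / 2))) := by
  intro W supp hmem V hV hVb suppV hsuppV oscV hoscV B S hB hS μ hμ ν hν F Λ KF hF
  have key := localScreening_of_pair hd hN hc hv hb hP hVB hρ hρ1 hmem hV hVb hsuppV hoscV (bV := fun e =>
    ∑ X ∈ (suppV {e}).filter (fun X => e ∈ X), oscV X e) (fun e => le_rfl) hB hS hμ hν hF
  refine key.trans (le_of_eq ?_)
  have h1 : (0 : ℝ) < 1 - max ρ (1 / 2) := sub_pos.2 (max_lt hρ1 (by norm_num))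
  field_simp

/-- **Clean reading, `1/2 ≤ ρ < 1`**: `LocalScreeningOnBallZd d N β ε₀ ε₁ R ((1−ρ)/max(1,R)) (√N/(1−ρ))`. -/
theorem localScreeningOnBallZd_of_pair_linear (hd : 1 ≤ d) (hN : 1 ≤ N) {β b c v ε₀ ε₁ ρ : ℝ} (R : ℝ)
    (hc : 0 ≤ c) (hv : 0 ≤ v) (hb : |β| * (2 * ((d : ℝ) - 1)) ≤ b)
    (hP : ∀ B : Matrix (Fin N) (Fin N) ℂ, matrixOpNorm B ≤ b →
      ∀ (ψ : Matrix.specialUnitaryGroup (Fin N) ℂ → ℝ) (M : ℝ), 0 ≤ M →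
        (∀ x y, |ψ x - ψ y| ≤ M * suFrobDist x y) →
        Var[ψ; (haarProbability (Matrix.specialUnitaryGroup (Fin N) ℂ)).tilted
          fun g => (N : ℝ) * ((g : Matrix (Fin N) (Fin N) ℂ) * B).trace.re] ≤ c * M ^ 2)
    (hVB : ∀ B : Matrix (Fin N) (Fin N) ℂ, matrixOpNorm B ≤ b → ∀ Δ : Matrix (Fin N) (Fin N) ℂ,
      Var[fun g : Matrix.specialUnitaryGroup (Fin N) ℂ =>
          (N : ℝ) * ((g : Matrix (Fin N) (Fin N) ℂ) * Δ).trace.re;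
        (haarProbability (Matrix.specialUnitaryGroup (Fin N) ℂ)).tilted
          fun g => (N : ℝ) * ((g : Matrix (Fin N) (Fin N) ℂ) * B).trace.re] ≤ v * frobNorm Δ ^ 2)
    (hρ : 6 * ((d : ℝ) - 1) * |β| * (exp ε₀ * Real.sqrt (c * v)) + exp (ε₀ / 2) * Real.sqrt c * ε₁ ≤ ρ)
    (hhalf : 1 / 2 ≤ ρ) (hρ1 : ρ < 1) :
    LocalScreeningOnBallZd d N β ε₀ ε₁ R ((1 - ρ) / max 1 R) (Real.sqrt N / (1 - ρ)) := by
  intro W supp hmem V hV hVb suppV hsuppV oscV hoscV B S hB hS μ hμ ν hν F Λ KF hF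
  have key := localScreening_of_pair_linear hd hN hc hv hb hP hVB hρ hhalf hρ1 hmem hV hVb hsuppV hoscV (bV := fun e =>
    ∑ X ∈ (suppV {e}).filter (fun X => e ∈ X), oscV X e) (fun e => le_rfl) hB hS hμ hν hF
  refine key.trans (le_of_eq ?_)
  have h1 : (0 : ℝ) < 1 - ρ := sub_pos.2 hρ1
  field_simp

/-! ### `SU(2)`, every `d`: the closed form; cells -/

/-- **`SU(2)`, EVERY `d`, HYPOTHESIS-FREE**: `2(d−1)|β_W| e^{ε₀} + e^{ε₀/2} √(2/3) ε₁ ≤ ρ`, `1/2 ≤ ρ < 1 ⇒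
LocalScreeningOnBallZd d 2 (β_W/4) ε₀ ε₁ R ((1−ρ)/max(1,R)) (√2/(1−ρ))`. -/
theorem su2_localScreeningOnBallZd (hd : 1 ≤ d) {βW ε₀ ε₁ ρ : ℝ} (R : ℝ)
    (hρ : 2 * ((d : ℝ) - 1) * |βW| * exp ε₀ + exp (ε₀ / 2) * Real.sqrt (2 / 3) * ε₁ ≤ ρ) (hhalf : 1 / 2 ≤ ρ)
    (hρ1 : ρ < 1) : LocalScreeningOnBallZd d 2 (βW / 4) ε₀ ε₁ R ((1 - ρ) / max 1 R) (Real.sqrt 2 / (1 - ρ)) := by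
  intro W supp hmem V hV hVb suppV hsuppV oscV hoscV B S hB hS μ hμ ν hν F Λ KF hF
  have key := su2_localScreening hd hρ hhalf hρ1 hmem hV hVb hsuppV hoscV (bV := fun e =>
    ∑ X ∈ (suppV {e}).filter (fun X => e ∈ X), oscV X e) (fun e => le_rfl) hB hS (μ := μ) (ν := ν)
    (by simpa using hμ) (by simpa using hν) hF
  refine key.trans (le_of_eq ?_)
  have h1 : (0 : ℝ) < 1 - ρ := sub_pos.2 hρ1
  field_simp

/-- The `d = 4` reading: `6|β_W| e^{ε₀} + e^{ε₀/2} √(2/3) ε₁ ≤ ρ`, `1/2 ≤ ρ < 1 ⇒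
LocalScreeningOnBallZd 4 2 (β_W/4) ε₀ ε₁ R ((1−ρ)/max(1,R)) (√2/(1−ρ))`. -/
theorem su2_localScreeningOnBallZd_dim4 {βW ε₀ ε₁ ρ : ℝ} (R : ℝ)
    (hρ : 6 * |βW| * exp ε₀ + exp (ε₀ / 2) * Real.sqrt (2 / 3) * ε₁ ≤ ρ) (hhalf : 1 / 2 ≤ ρ) (hρ1 : ρ < 1) :
    LocalScreeningOnBallZd 4 2 (βW / 4) ε₀ ε₁ R ((1 - ρ) / max 1 R) (Real.sqrt 2 / (1 - ρ)) :=
  su2_localScreeningOnBallZd (by norm_num) R (by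
    have h6 : (2 : ℝ) * (((4 : ℕ) : ℝ) - 1) = 6 := by norm_num
    rw [h6]; exact hρ) hhalf hρ1

/-- **Lineage-(A) row from the numeric majorants** (`T` = `exp_le_taylor4`, `√(2/3) ≤ 0.8165`): for `0 ≤ β_W`,
`0 ≤ ε ≤ 1/2` and `6 β_W T(2ε) + T(ε)·0.8165·ε ≤ ρ`, `1/2 ≤ ρ < 1`:
`LocalScreeningOnBallZd 4 2 (β_W/4) (2ε) ε R ((1−ρ)/max(1,R)) (√2/(1−ρ))`. -/
theorem su2_screeningRowA {βW ε ρ : ℝ} (R : ℝ) (hβ : 0 ≤ βW) (hε0 : 0 ≤ ε) (hε1 : ε ≤ 1 / 2)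
    (h : 6 * βW * (1 + 2 * ε + (2 * ε) ^ 2 / 2 + (2 * ε) ^ 3 / 6 + 5 / 96 * (2 * ε) ^ 4) +
      (1 + ε + ε ^ 2 / 2 + ε ^ 3 / 6 + 5 / 96 * ε ^ 4) * (8165 / 10000) * ε ≤ ρ)
    (hhalf : 1 / 2 ≤ ρ) (hρ1 : ρ < 1) :
    LocalScreeningOnBallZd 4 2 (βW / 4) (2 * ε) ε R ((1 - ρ) / max 1 R) (Real.sqrt 2 / (1 - ρ)) := by
  refine su2_localScreeningOnBallZd_dim4 R ?_ hhalf hρ1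
  have h1 := exp_le_taylor4 (x := 2 * ε) (by linarith) (by linarith)
  have h2 := exp_le_taylor4 (x := ε) hε0 (by linarith)
  rw [abs_of_nonneg hβ, show 2 * ε / 2 = ε by ring]
  calc 6 * βW * exp (2 * ε) + exp ε * Real.sqrt (2 / 3) * ε
      ≤ 6 * βW * (1 + 2 * ε + (2 * ε) ^ 2 / 2 + (2 * ε) ^ 3 / 6 + 5 / 96 * (2 * ε) ^ 4) +
        (1 + ε + ε ^ 2 / 2 + ε ^ 3 / 6 + 5 / 96 * ε ^ 4) * (8165 / 10000) * ε := by
        gcongr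
        · exact sqrt_two_thirds_le
    _ ≤ ρ := h

/-- **Cell `(β_W, ε) = (1/8, 1/20)`**: row sum `≤ 7/8` ⇒ on `MemBallZd (1/10) (1/20) R` at `β_W = 1/8` every source is
screened at rate `(1/8)/max(1,R)` with constant `8√2 · min(B,4) · #Λ · K_F`. -/
theorem su2_localScreeningOnBallZd_1_8 (R : ℝ) :
    LocalScreeningOnBallZd 4 2 ((1 / 8 : ℝ) / 4) (2 * (1 / 20)) (1 / 20) R ((1 - 7 / 8) / max 1 R)
      (Real.sqrt 2 / (1 - 7 / 8)) :=
  su2_screeningRowA R (by norm_num) (by norm_num) (by norm_num) (by norm_num) (by norm_num) (by norm_num)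

/-- **Cell `(β_W, ε) = (1/10, 1/10)`**: row sum `≤ 7/8` ⇒ rate `(1/8)/max(1,R)`, constant `8√2 · min(B,4) · #Λ · K_F`. -/
theorem su2_localScreeningOnBallZd_1_10 (R : ℝ) :
    LocalScreeningOnBallZd 4 2 ((1 / 10 : ℝ) / 4) (2 * (1 / 10)) (1 / 10) R ((1 - 7 / 8) / max 1 R)
      (Real.sqrt 2 / (1 - 7 / 8)) :=
  su2_screeningRowA R (by norm_num) (by norm_num) (by norm_num) (by norm_num) (by norm_num) (by norm_num)

/-! ### Every `N ≥ 2`: the Bakry–Émery pair, hypothesis-free -/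

/-- **ALL `N ≥ 2`, EVERY `d ≥ 1`, HYPOTHESIS-FREE** (Bakry–Émery pair, `b = 2(d−1)|β| < 1/2`):
`6(d−1)|β| e^{ε₀}/(1/2 − b) + e^{ε₀/2} ε₁/√(N(1/2 − b)) ≤ ρ`, `1/2 ≤ ρ < 1 ⇒
LocalScreeningOnBallZd d N β ε₀ ε₁ R ((1−ρ)/max(1,R)) (√N/(1−ρ))`. -/
theorem suN_localScreeningOnBallZd_bakryEmery (hd : 1 ≤ d) (hN : 2 ≤ N) {β ε₀ ε₁ ρ : ℝ} (R : ℝ)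
    (hb : |β| * (2 * ((d : ℝ) - 1)) < 1 / 2)
    (hρ : 6 * ((d : ℝ) - 1) * |β| * exp ε₀ / (1 / 2 - |β| * (2 * ((d : ℝ) - 1))) +
      exp (ε₀ / 2) * ε₁ / Real.sqrt ((N : ℝ) * (1 / 2 - |β| * (2 * ((d : ℝ) - 1)))) ≤ ρ)
    (hhalf : 1 / 2 ≤ ρ) (hρ1 : ρ < 1) :
    LocalScreeningOnBallZd d N β ε₀ ε₁ R ((1 - ρ) / max 1 R) (Real.sqrt N / (1 - ρ)) := by
  intro W supp hmem V hV hVb suppV hsuppV oscV hoscV B S hB hS μ hμ ν hν F Λ KF hF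
  have key := suN_localScreening_bakryEmery hd hN hb hρ hhalf hρ1 hmem hV hVb hsuppV hoscV (bV := fun e =>
    ∑ X ∈ (suppV {e}).filter (fun X => e ∈ X), oscV X e) (fun e => le_rfl) hB hS hμ hν hF
  refine key.trans (le_of_eq ?_)
  have h1 : (0 : ℝ) < 1 - ρ := sub_pos.2 hρ1
  field_simp

end Summit.Ventures.YMGap.RobustBall

end
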